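import Mathlib.Analysis.Analytic.Basic
import Mathlib.Analysis.Calculus.FDeriv.Analytic
import Mathlib.Analysis.Complex.Basic
import Literature.Analysis.Calculus.CauchyBinomialRegrouping
import Literature.NumberTheory.Automorphic.InfUnitaryHilbertCompletion
import HarnessLib

/-!
# The exponential series of a skew operator on analytic vectors, I: the series, the weak identity, the isometry

Topic `NumberTheory/Automorphic`; namespace `Literature.NumberTheory.Automorphic.IsPosDefHerm` (dot notation on `hB : IsPosDefHerm B`, over ★
`InfUnitaryHilbertCompletion`: `hB.E`, `hB.emb`); sequel `InfUnitaryLocalExponentialOperator` (the bounded operator, local group law, unitarity,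
power series in time, covariance).  Cell `hodgecm-mathlib`, F0∕P3, ROAD-GLOB to the letter A6 #92 `HasUnitaryGlobalizationOfInfUnitary`
[KnappVogan1995, Thm. 0.6 (a)] at `U(2,1)`, brick **P1** (LEAD amendments v1.1 (a): the factorial bound (FB) is TAKEN AS A HYPOTHESIS, per vector:
`‖emb (Zⁿ v)‖ ≤ C_v · n! · Kⁿ`).  One definition WITH BODY (`expVec`) + theorems; no named fact, no instance, no notation, no `sorry`.

THE MATHEMATICS ([HarishChandra1953, §9]; [Nelson1959, §2]; [KnappVogan1995, Introduction (0.5)–Thm. 0.6]).  Let `(V, B)` be a complex vector space with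
a positive definite Hermitian form, `E ⊇ emb V` its Hilbert completion (★ G0), and `Z` a `B`-SKEW operator on `V` (`B (Z x) y = −B x (Z y)`) whose vectors
are ANALYTIC with a uniform radius: `‖emb (Zⁿ v)‖ ≤ C_v n! Kⁿ`.  For real `a` with `|a| K < 1` the exponential series
`expVec Z a v := Σ_n (aⁿ∕n!) • emb (Zⁿ v)` converges in `E` (`hasSum_expVec`), `expVec Z 0 v = emb v`, and skewness gives the matrix coefficients
`⟪(aᵐ∕m!) emb Zᵐ v, (bⁿ∕n!) emb Zⁿ w⟫ = ((−a)ᵐ bⁿ∕(m! n!)) ⟪emb v, emb Z^{m+n} w⟫`; the Cauchy–binomial regrouping (★ `CauchyBinomialRegrouping`) of the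
absolutely convergent double series yields **the weak identity** `⟪expVec Z a v, expVec Z b w⟫ = ⟪emb v, expVec Z (b − a) w⟫` for `(|a|+|b|) K < 1`
(`inner_expVec_expVec`), in particular **the isometry** `⟪expVec Z a v, expVec Z a w⟫ = B v w`, `‖expVec Z a v‖ = ‖emb v‖` (`2|a|K < 1`).  Also:
the bound passes to `Zᵏ v` with `K ↦ 2K` (`bound_pow_apply`).

HONEST LABEL: brick P1 of the road; closes no registered stub.  HC_CM is proved only modulo the 2 remaining named inputs (hLiu418, h413) until rung 0 closes.

## Mathlib ∕ tree search
Mathlib: `tsum`, `HasSum.mapL`, `innerSL`, `inner_conj_symm`, `inner_smul_real_left/right`, `RCLike.real_smul_eq_coe_smul`, `summable_geometric_of_lt_one`,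
`Summable.of_norm_bounded`.  Tree: ★ `IsPosDefHerm.inner_emb_emb`∕`inner_emb_map_eq_neg` (G0), ★ `CauchyBinomial.hasSum_iterated`.  Dedup:
`rg "expVec|inner_emb_pow_left"` over `Literature/` — no hits.

## References
* Harish-Chandra, *Representations of a semisimple Lie group on a Banach space. I*, Trans. AMS 75 (1953), §9 [HarishChandra1953].
* E. Nelson, *Analytic vectors*, Ann. of Math. 70 (1959), §2 [Nelson1959].
* A. W. Knapp, D. A. Vogan, *Cohomological Induction and Unitary Representations* (1995), Introduction (0.5), Thm. 0.6 [KnappVogan1995].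
-/

set_option autoImplicit false

noncomputable section

open Finset
open scoped Nat InnerProductSpace ComplexConjugate

namespace Literature.NumberTheory.Automorphic

namespace IsPosDefHerm

universe u

variable {V : Type u} [AddCommGroup V] [Module ℂ V] {B : V →ₗ⋆[ℂ] V →ₗ[ℂ] ℂ} (hB : IsPosDefHerm B)
include hB

/-! ## §2 The exponential series on `emb V` -/

/-- **`expVec Z a v := Σ_n (aⁿ ∕ n!) • emb (Zⁿ v)`** — the exponential series of the operator `a Z` at the vector `v`, summed in `E`
(junk when not summable). [cite: HarishChandra1953, §9] [cite: Nelson1959, §2] -/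
def expVec (Z : V →ₗ[ℂ] V) (a : ℝ) (v : V) : hB.E :=
  ∑' n : ℕ, (a ^ n / (n ! : ℝ)) • hB.emb ((Z ^ n) v)

variable (Z : V →ₗ[ℂ] V)

/-- The norm of the `n`-th term under a factorial bound: `‖(aⁿ∕n!) • emb (Zⁿ v)‖ ≤ C (|a| K)ⁿ`. [cite: Nelson1959, §2] -/
theorem norm_expTerm_le {K C : ℝ} {v : V} (hv : ∀ n, ‖hB.emb ((Z ^ n) v)‖ ≤ C * n ! * K ^ n) (a : ℝ) (n : ℕ) :
    ‖(a ^ n / (n ! : ℝ)) • hB.emb ((Z ^ n) v)‖ ≤ C * (|a| * K) ^ n := by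
  rw [norm_smul, Real.norm_eq_abs, abs_div, abs_pow, abs_of_pos (by positivity : (0 : ℝ) < n !)]
  have hn : (0 : ℝ) < n ! := by positivity
  calc |a| ^ n / (n ! : ℝ) * ‖hB.emb ((Z ^ n) v)‖ ≤ |a| ^ n / (n ! : ℝ) * (C * n ! * K ^ n) := by
        gcongr; exact hv n
    _ = C * (|a| * K) ^ n := by field_simp; ring

/-- **Summability** of the exponential series for `|a| K < 1`. [cite: Nelson1959, §2] -/
theorem summable_expTerm {K C : ℝ} (hK : 0 ≤ K) {v : V} (hv : ∀ n, ‖hB.emb ((Z ^ n) v)‖ ≤ C * n ! * K ^ n) {a : ℝ}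
    (ha : |a| * K < 1) : Summable fun n : ℕ => (a ^ n / (n ! : ℝ)) • hB.emb ((Z ^ n) v) := by
  refine Summable.of_norm_bounded (g := fun n => C * (|a| * K) ^ n) ?_ (hB.norm_expTerm_le Z hv a)
  exact (summable_geometric_of_lt_one (by positivity) ha).mul_left C

/-- `HasSum` form of the definition. [cite: Nelson1959, §2] -/
theorem hasSum_expVec {K C : ℝ} (hK : 0 ≤ K) {v : V} (hv : ∀ n, ‖hB.emb ((Z ^ n) v)‖ ≤ C * n ! * K ^ n) {a : ℝ}
    (ha : |a| * K < 1) : HasSum (fun n : ℕ => (a ^ n / (n ! : ℝ)) • hB.emb ((Z ^ n) v)) (hB.expVec Z a v) :=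
  (hB.summable_expTerm Z hK hv ha).hasSum

/-- At `a = 0` the series is `emb v` (no hypothesis). [cite: Nelson1959, §2] -/
theorem expVec_zero (v : V) : hB.expVec Z 0 v = hB.emb v := by
  unfold expVec
  rw [tsum_eq_single 0]
  · simp
  · intro n hn
    simp [zero_pow hn]

/-- **The factorial bound passes to `Zᵏ v`** with `K ↦ 2K`: `‖emb (Zⁿ (Zᵏ v))‖ ≤ (C k! (2K)ᵏ) · n! · (2K)ⁿ` (from `(n+k)! ≤ 2^{n+k} n! k!`).
[cite: Nelson1959, §2] -/
theorem bound_pow_apply {K C : ℝ} (hK : 0 ≤ K) {v : V} (hv : ∀ n, ‖hB.emb ((Z ^ n) v)‖ ≤ C * n ! * K ^ n) (k n : ℕ) :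
    ‖hB.emb ((Z ^ n) ((Z ^ k) v))‖ ≤ (C * k ! * (2 * K) ^ k) * n ! * (2 * K) ^ n := by
  have hC : 0 ≤ C := by
    have h0 := hv 0
    simp only [pow_zero, Nat.factorial_zero, Nat.cast_one, mul_one] at h0
    exact (norm_nonneg _).trans h0
  rw [← Module.End.mul_apply, ← pow_add]
  refine (hv (n + k)).trans ?_
  have hfac : ((n + k) ! : ℝ) ≤ 2 ^ (n + k) * (n ! * k !) := by
    have h := Nat.add_choose_mul_factorial_mul_factorial n k
    have hc : (n + k).choose k ≤ 2 ^ (n + k) := Nat.choose_le_two_pow _ _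
    have : ((n + k) ! : ℝ) = ((n + k).choose k : ℝ) * n ! * k ! := by exact_mod_cast h.symm
    rw [this]
    have hc' : ((n + k).choose k : ℝ) ≤ 2 ^ (n + k) := by exact_mod_cast hc
    nlinarith [hc', (by positivity : (0 : ℝ) < n ! * k !)]
  calc C * ((n + k) ! : ℝ) * K ^ (n + k) ≤ C * (2 ^ (n + k) * (n ! * k !)) * K ^ (n + k) := by gcongr
    _ = (C * k ! * (2 * K) ^ k) * n ! * (2 * K) ^ n := by rw [pow_add, pow_add, mul_pow, mul_pow]; ring

/-! ## §3 The weak identity and the isometry -/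

/-- Skewness iterated: `⟪emb (Zᵐ v), emb w⟫ = (−1)ᵐ ⟪emb v, emb (Zᵐ w)⟫`. [cite: KnappVogan1995, Introduction (0.5)] -/
theorem inner_emb_pow_left (hZ : ∀ x y, B (Z x) y = -B x (Z y)) (m : ℕ) (v w : V) :
    ⟪hB.emb ((Z ^ m) v), hB.emb w⟫_ℂ = (-1 : ℂ) ^ m * ⟪hB.emb v, hB.emb ((Z ^ m) w)⟫_ℂ := by
  induction m generalizing v w with
  | zero => simp
  | succ m ih =>
    rw [pow_succ, Module.End.mul_apply, ih (Z v) w, hB.inner_emb_map_eq_neg hZ, ← Module.End.mul_apply, ← pow_succ',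
      ← pow_succ]
    ring

/-- The matrix coefficient of two terms: `⟪(aᵐ∕m!)•emb(Zᵐv), (bⁿ∕n!)•emb(Zⁿw)⟫ = ((−a)ᵐ bⁿ∕(m!n!)) • ⟪emb v, emb (Z^{m+n} w)⟫`.
[cite: HarishChandra1953, §9] -/
theorem inner_expTerm_expTerm (hZ : ∀ x y, B (Z x) y = -B x (Z y)) (a b : ℝ) (m n : ℕ) (v w : V) :
    ⟪(a ^ m / (m ! : ℝ)) • hB.emb ((Z ^ m) v), (b ^ n / (n ! : ℝ)) • hB.emb ((Z ^ n) w)⟫_ℂ =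
      ((-a) ^ m * b ^ n / ((m ! : ℝ) * (n ! : ℝ))) • ⟪hB.emb v, hB.emb ((Z ^ (m + n)) w)⟫_ℂ := by
  rw [RCLike.real_smul_eq_coe_smul (K := ℂ) (a ^ m / (m ! : ℝ)), RCLike.real_smul_eq_coe_smul (K := ℂ) (b ^ n / (n ! : ℝ)),
    inner_smul_real_left, inner_smul_real_right, hB.inner_emb_pow_left Z hZ m, pow_add, Module.End.mul_apply,
    Complex.real_smul, Complex.real_smul, Complex.real_smul, neg_pow a m]
  push_cast
  ring

/-- **THE WEAK IDENTITY** `⟪expVec Z a v, expVec Z b w⟫ = ⟪emb v, expVec Z (b − a) w⟫` for `B`-skew `Z`, factorial bounds at `v, w` and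
`(|a|+|b|) K < 1` (Cauchy–binomial regrouping of the absolutely convergent double series). [cite: HarishChandra1953, §9] [cite: Nelson1959, §2] -/
theorem inner_expVec_expVec (hZ : ∀ x y, B (Z x) y = -B x (Z y)) {K Cv Cw : ℝ} (hK : 0 ≤ K) {v w : V}
    (hv : ∀ n, ‖hB.emb ((Z ^ n) v)‖ ≤ Cv * n ! * K ^ n) (hw : ∀ n, ‖hB.emb ((Z ^ n) w)‖ ≤ Cw * n ! * K ^ n)
    {a b : ℝ} (hab : (|a| + |b|) * K < 1) :
    ⟪hB.expVec Z a v, hB.expVec Z b w⟫_ℂ = ⟪hB.emb v, hB.expVec Z (b - a) w⟫_ℂ := by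
  have ha : |a| * K < 1 := lt_of_le_of_lt (by nlinarith [abs_nonneg b]) hab
  have hb : |b| * K < 1 := lt_of_le_of_lt (by nlinarith [abs_nonneg a]) hab
  have hba : |b - a| * K < 1 :=
    lt_of_le_of_lt (mul_le_mul_of_nonneg_right ((abs_sub _ _).trans (by rw [add_comm])) hK) hab
  -- the scalar family `F N = ⟪emb v, emb (Z^N w)⟫` and its Cauchy–binomial hypothesis with scalars `(−a, b)`
  set F : ℕ → ℂ := fun N => ⟪hB.emb v, hB.emb ((Z ^ N) w)⟫_ℂ with hF
  have hFs : Summable fun N => (|(-a)| + |b|) ^ N / (N ! : ℝ) * ‖F N‖ := by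
    rw [abs_neg]
    refine Summable.of_nonneg_of_le (fun N => by positivity) (fun N => ?_)
      ((summable_geometric_of_lt_one (by positivity) hab).mul_left (‖hB.emb v‖ * Cw))
    have hN : (0 : ℝ) < N ! := by positivity
    calc (|a| + |b|) ^ N / (N ! : ℝ) * ‖F N‖ ≤ (|a| + |b|) ^ N / (N ! : ℝ) * (‖hB.emb v‖ * (Cw * N ! * K ^ N)) := by
          gcongr; exact (norm_inner_le_norm _ _).trans (by gcongr; exact hw N)
      _ = ‖hB.emb v‖ * Cw * ((|a| + |b|) * K) ^ N := by rw [mul_pow]; field_simp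
  -- Step 1∕2: expand the inner product of the two sums as an iterated sum (outer `n`, inner `m`)
  have hsv := hB.hasSum_expVec Z hK hv ha
  have hsw := hB.hasSum_expVec Z hK hw hb
  have hstep : HasSum (fun n : ℕ => ∑' m : ℕ, ((-a) ^ m * b ^ n / ((m ! : ℝ) * (n ! : ℝ))) • F (m + n))
      ⟪hB.expVec Z a v, hB.expVec Z b w⟫_ℂ := by
    have h1 : HasSum (fun n : ℕ => ⟪hB.expVec Z a v, (b ^ n / (n ! : ℝ)) • hB.emb ((Z ^ n) w)⟫_ℂ)
        ⟪hB.expVec Z a v, hB.expVec Z b w⟫_ℂ := hsw.mapL (innerSL ℂ (hB.expVec Z a v))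
    refine h1.congr_fun fun n => ?_
    -- inner sum over `m`
    have h2 : HasSum (fun m : ℕ => ⟪(a ^ m / (m ! : ℝ)) • hB.emb ((Z ^ m) v), (b ^ n / (n ! : ℝ)) • hB.emb ((Z ^ n) w)⟫_ℂ)
        ⟪hB.expVec Z a v, (b ^ n / (n ! : ℝ)) • hB.emb ((Z ^ n) w)⟫_ℂ := by
      have h3 := hsv.mapL (innerSL ℂ ((b ^ n / (n ! : ℝ)) • hB.emb ((Z ^ n) w)))
      have h4 : HasSum (fun m : ℕ => conj ⟪(b ^ n / (n ! : ℝ)) • hB.emb ((Z ^ n) w), (a ^ m / (m ! : ℝ)) • hB.emb ((Z ^ m) v)⟫_ℂ)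
          (conj ⟪(b ^ n / (n ! : ℝ)) • hB.emb ((Z ^ n) w), hB.expVec Z a v⟫_ℂ) :=
        (h3.mapL (Complex.conjCLE : ℂ →L[ℝ] ℂ))
      simpa only [innerSL_apply_apply, inner_conj_symm] using h4
    rw [← h2.tsum_eq]
    exact tsum_congr fun m => (hB.inner_expTerm_expTerm Z hZ a b m n v w).symm
  -- Step 3: Cauchy–binomial
  have hcb := CauchyBinomial.hasSum_iterated (-a) b F hFs
  have heq := hstep.unique hcb
  rw [heq, show -a + b = b - a by ring]
  -- Step 4: fold back `⟪emb v, expVec Z (b−a) w⟫`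
  have h5 := (hB.hasSum_expVec Z hK hw hba).mapL (innerSL ℂ (hB.emb v))
  simp only [innerSL_apply_apply] at h5
  rw [← h5.tsum_eq]
  refine tsum_congr fun N => ?_
  rw [Complex.real_smul, RCLike.real_smul_eq_coe_smul (K := ℂ), inner_smul_real_right, Complex.real_smul]

/-- **ISOMETRY**: `⟪expVec Z a v, expVec Z a w⟫ = B v w` for `2|a|K < 1`. [cite: HarishChandra1953, §9] -/
theorem inner_expVec_expVec_same (hZ : ∀ x y, B (Z x) y = -B x (Z y)) {K Cv Cw : ℝ} (hK : 0 ≤ K) {v w : V}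
    (hv : ∀ n, ‖hB.emb ((Z ^ n) v)‖ ≤ Cv * n ! * K ^ n) (hw : ∀ n, ‖hB.emb ((Z ^ n) w)‖ ≤ Cw * n ! * K ^ n)
    {a : ℝ} (ha : 2 * |a| * K < 1) : ⟪hB.expVec Z a v, hB.expVec Z a w⟫_ℂ = B v w := by
  rw [hB.inner_expVec_expVec Z hZ hK hv hw (by linarith), sub_self, hB.expVec_zero, hB.inner_emb_emb]

/-- **`‖expVec Z a v‖ = ‖emb v‖`** for `2|a|K < 1`. [cite: HarishChandra1953, §9] -/
theorem norm_expVec (hZ : ∀ x y, B (Z x) y = -B x (Z y)) {K C : ℝ} (hK : 0 ≤ K) {v : V}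
    (hv : ∀ n, ‖hB.emb ((Z ^ n) v)‖ ≤ C * n ! * K ^ n) {a : ℝ} (ha : 2 * |a| * K < 1) :
    ‖hB.expVec Z a v‖ = ‖hB.emb v‖ := by
  have h := hB.inner_expVec_expVec_same Z hZ hK hv hv ha
  rw [← hB.inner_emb_emb] at h
  have h1 : ‖hB.expVec Z a v‖ ^ 2 = ‖hB.emb v‖ ^ 2 := by
    rw [@norm_sq_eq_re_inner ℂ, @norm_sq_eq_re_inner ℂ, h]
  exact (sq_eq_sq₀ (norm_nonneg _) (norm_nonneg _)).mp h1

end IsPosDefHerm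

end Literature.NumberTheory.Automorphic

end
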